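import Literature.MeasureTheory.Group.HaarTubePushforwardMeasure
import HarnessLib

/-!
# The invariant tube of a compact linear group, with its product structure exposed

`HaarTubePushforward(Measure).lean` prove that the Haar measure of a compact group `K`, embedded by
a continuous injective multiplicative `ρ : K →* 𝔸` into a finite-dimensional real Banach algebra,
is (a constant multiple of) the push-forward of Lebesgue measure on a compact tube
`Ω = {M ∈ T : g(M) ≥ 0}` under the group-part projection; their exported statements hide the
product structure of the tube. This file re-exports the same construction with the structure
VISIBLE, as needed when the phase of a Laplace integral over `Ω` is to be read in the product
coordinates `(h, A) ↦ h(1 + A)` of the tube (`H = ρ(K)`, `A` in a complement `𝔨` of the Lie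
algebra):

* `haar_lintegral_eq_of_invariantTube` — the measure-theoretic half of
  `exists_haar_lintegral_eq_tube`, with its inputs (an `H`-invariant compact `Ω ⊆ T` with
  non-empty interior and an equivariant lift `qK : T → K`) as hypotheses: then
  `c ∫ F dHaar_K = ∫_Ω F ∘ qK dμ` for some `0 < c < ∞` (left invariance of `qK_*(μ|_Ω)` and
  uniqueness of Haar measure);
* `exists_invariantTube'` — the tube `T = {h(1 + A) : h ∈ H, A ∈ 𝔨, ‖A‖ < r}` with BOTH analytic
  projections `q(h(1+A)) = h`, `a(h(1+A)) = A`, the complement `𝔨`, the radius `r`, the cut-off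
  `g(M) = ρ₀² - Σᵢ eᵢ(a M)²` in Euclidean coordinates `e`, `Ω = {M ∈ T : 0 ≤ g M}` compact with
  `1 ∈ interior Ω`, and the equivariant lift `qK` (the proof of `exists_invariantTube`, verbatim,
  with a longer conclusion).

Everything is proved; no definitions, no named facts.

## References

* B. C. Hall, *Lie Groups, Lie Algebras, and Representations*, 2nd ed. (2015), Thm. 3.42,
  Cor. 3.45. [Hall2015]
-/

noncomputable section

open NormedSpace Filter Topology Set Metric Function MeasureTheory MeasureTheory.Measure
open scoped ENNReal NNReal

namespace Literature.MeasureTheory.Group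

open Literature.Analysis.Calculus

variable {𝔸 : Type*} [NormedRing 𝔸] [NormedAlgebra ℚ 𝔸] [NormedAlgebra ℝ 𝔸] [CompleteSpace 𝔸]
  [FiniteDimensional ℝ 𝔸]
variable {K : Type*} [Group K] [TopologicalSpace K] [IsTopologicalGroup K] [CompactSpace K]

section Measure

variable [MeasurableSpace 𝔸] [BorelSpace 𝔸] [MeasurableSpace K] [BorelSpace K]

omit [NormedAlgebra ℚ 𝔸] [CompleteSpace 𝔸] in
/-- **Haar measure as a push-forward, from an invariant tube.** Let `ρ : K →* 𝔸` be continuous,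
`Ω ⊆ T ⊆ 𝔸` with `Ω` compact, `1 ∈ interior Ω`, `Ω` invariant under left multiplication by every
`ρ k`, and `qK : 𝔸 → K` continuous on `T` with `ρ k · M ∈ T`, `qK (ρ k · M) = k · qK M` for
`M ∈ T`. Then `qK_*(μ|_Ω)` is a non-zero finite left-invariant measure on the compact group `K`,
hence `c · Haar` with `0 < c < ∞`: `c ∫ F dHaar_K = ∫_Ω F (qK M) dμ(M)` for all measurable
`F : K → [0, ∞]`. [folklore] -/
theorem haar_lintegral_eq_of_invariantTube (ρ : K →* 𝔸) (hρc : Continuous ρ)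
    (μ : Measure 𝔸) [μ.IsAddHaarMeasure] {T Ω : Set 𝔸} {qK : 𝔸 → K}
    (hΩT : Ω ⊆ T) (hΩcpt : IsCompact Ω) (h1int : (1 : 𝔸) ∈ interior Ω)
    (hqKcont : ContinuousOn qK T)
    (hTinv : ∀ k : K, ∀ M ∈ T, ρ k * M ∈ T ∧ qK (ρ k * M) = k * qK M)
    (hΩinv : ∀ k : K, (fun M => ρ k * M) ⁻¹' Ω = Ω) :
    ∃ c : ℝ≥0∞, c ≠ 0 ∧ c ≠ ∞ ∧
      ∀ F : K → ℝ≥0∞, Measurable F →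
        c * ∫⁻ k, F k ∂haarMeasure ⊤ = ∫⁻ M in Ω, F (qK M) ∂μ := by
  have hΩmeas : MeasurableSet Ω := hΩcpt.isClosed.measurableSet
  have hqKae : AEMeasurable qK (μ.restrict Ω) := (hqKcont.mono hΩT).aemeasurable hΩmeas
  haveI : IsFiniteMeasure (μ.restrict Ω) :=
    ⟨by rw [Measure.restrict_apply_univ]; exact hΩcpt.measure_lt_top⟩
  set ν : Measure K := Measure.map qK (μ.restrict Ω) with hν
  haveI : IsFiniteMeasure ν := Measure.isFiniteMeasure_map _ _
  -- left invariance of `ν`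
  have hmapL : ∀ k : K, Measure.map (fun M => ρ k * M) (μ.restrict Ω) = μ.restrict Ω := by
    intro k
    have hLmeas : Measurable fun M : 𝔸 => ρ k * M := measurable_const_mul (ρ k)
    have h := Measure.restrict_map (μ := μ) hLmeas hΩmeas
    rw [map_mulLeft_addHaar ρ hρc μ k, hΩinv k] at h
    exact h.symm
  haveI : IsMulLeftInvariant ν := by
    refine ⟨fun k => ?_⟩
    have hkm : Measurable fun x : K => k * x := measurable_const_mul k
    calc Measure.map (fun x => k * x) ν
        = Measure.map ((fun x => k * x) ∘ qK) (μ.restrict Ω) :=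
          AEMeasurable.map_map_of_aemeasurable hkm.aemeasurable hqKae
      _ = Measure.map (qK ∘ fun M => ρ k * M) (μ.restrict Ω) := by
          refine Measure.map_congr (ae_restrict_of_forall_mem hΩmeas fun M hM => ?_)
          simp only [Function.comp_apply]
          exact ((hTinv k M (hΩT hM)).2).symm
      _ = Measure.map qK (Measure.map (fun M => ρ k * M) (μ.restrict Ω)) := by
          refine (AEMeasurable.map_map_of_aemeasurable ?_
            (measurable_const_mul (ρ k)).aemeasurable).symm
          rw [hmapL k]; exact hqKae
      _ = ν := by rw [hmapL k]
  -- uniqueness of Haar measure on the compact group `K`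
  have hνeq : ν = haarScalarFactor ν (haarMeasure ⊤) • haarMeasure ⊤ :=
    Measure.isMulInvariant_eq_smul_of_compactSpace ν (haarMeasure ⊤)
  set c : ℝ≥0 := haarScalarFactor ν (haarMeasure ⊤) with hc
  -- `ν ≠ 0`
  have hνuniv : ν univ = μ Ω := by
    rw [hν, Measure.map_apply_of_aemeasurable hqKae MeasurableSet.univ, preimage_univ,
      Measure.restrict_apply_univ]
  have hΩpos : 0 < μ Ω :=
    (isOpen_interior.measure_pos μ ⟨1, h1int⟩).trans_le (measure_mono interior_subset)
  have hc0 : (c : ℝ≥0∞) ≠ 0 := by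
    intro h0
    have : ν = 0 := by
      rw [hνeq]
      have : c = 0 := by exact_mod_cast h0
      rw [this, zero_smul]
    rw [this, Measure.coe_zero, Pi.zero_apply] at hνuniv
    exact hΩpos.ne' hνuniv.symm
  refine ⟨c, hc0, ENNReal.coe_ne_top, fun F hF => ?_⟩
  calc (c : ℝ≥0∞) * ∫⁻ k, F k ∂haarMeasure ⊤ = ∫⁻ k, F k ∂((c : ℝ≥0∞) • haarMeasure ⊤) := by
        rw [lintegral_smul_measure, smul_eq_mul]
    _ = ∫⁻ k, F k ∂ν := by rw [hνeq, ENNReal.smul_def]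
    _ = ∫⁻ M in Ω, F (qK M) ∂μ := lintegral_map' (hF.aemeasurable) hqKae

end Measure

section Tube

omit [IsTopologicalGroup K] in
/-- **The invariant tube of a compact linear group, with its product structure.** For a continuous
injective multiplicative `ρ : K →* 𝔸` from a compact group, with `H = ρ(K)`: a complement `𝔨` of
the Lie algebra of `H`, a radius `r > 0`, the open tube `T = {h(1 + A) : h ∈ H, A ∈ 𝔨, ‖A‖ < r}`,
the analytic projections `q`, `a` on `T` (`q(h(1+A)) = h`, `a(h(1+A)) = A`, `M = q M (1 + a M)`,
`q(hM) = h q M`, `a(hM) = a M`), a radius `ρ₀ > 0` with the cut-off `g M = ρ₀² - Σᵢ eᵢ(a M)²`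
(`e` the Euclidean coordinates of `𝔸`) such that `Σᵢ eᵢ(A)² ≤ ρ₀²` forces `‖A‖ < r`, the compact
`Ω = {M ∈ T : 0 ≤ g M}` with `1 ∈ interior Ω`, and the equivariant continuous lift `qK : T → K`,
`ρ (qK M) = q M`, with `T`, `Ω` invariant under left multiplication by `H`.
[cite: Hall2015, Theorem 3.42 and Corollary 3.45] -/
theorem exists_invariantTube' (ρ : K →* 𝔸) (hρc : Continuous ρ) (hρi : Injective ρ) :
    ∃ (𝔨 : Submodule ℝ 𝔸) (r ρ₀ : ℝ) (T Ω : Set 𝔸) (q a : 𝔸 → 𝔸) (g : 𝔸 → ℝ) (qK : 𝔸 → K),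
      0 < r ∧ 0 < ρ₀ ∧
      T = {M : 𝔸 | ∃ h ∈ range ρ, ∃ A ∈ 𝔨, ‖A‖ < r ∧ M = h * (1 + A)} ∧
      (g = fun M => ρ₀ ^ 2 - ∑ i, (toEuclidean (a M) i) ^ 2) ∧
      Ω = {M ∈ T | 0 ≤ g M} ∧
      IsOpen T ∧ Ω ⊆ T ∧ IsCompact Ω ∧ (1 : 𝔸) ∈ interior Ω ∧
      (∀ h ∈ range ρ, ∀ A ∈ 𝔨, ‖A‖ < r → q (h * (1 + A)) = h ∧ a (h * (1 + A)) = A) ∧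
      (∀ M ∈ T, q M ∈ range ρ ∧ a M ∈ 𝔨 ∧ ‖a M‖ < r ∧ M = q M * (1 + a M)) ∧
      (∀ h ∈ range ρ, ∀ M ∈ T, h * M ∈ T ∧ q (h * M) = h * q M ∧ a (h * M) = a M) ∧
      AnalyticOnNhd ℝ q T ∧ AnalyticOnNhd ℝ a T ∧
      (∀ A : 𝔸, ∑ i, (toEuclidean A i) ^ 2 ≤ ρ₀ ^ 2 → ‖A‖ < r) ∧
      ContinuousOn qK T ∧ q 1 = 1 ∧ (∀ M ∈ T, ρ (qK M) = q M) ∧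
      (∀ k : K, ∀ M ∈ T, ρ k * M ∈ T ∧ qK (ρ k * M) = k * qK M) ∧
      (∀ k : K, (fun M => ρ k * M) ⁻¹' Ω = Ω) := by
  classical
  set H : Set 𝔸 := range ρ with hHdef
  have hH : IsClosed H := (isCompact_range hρc).isClosed
  have h1 : (1 : 𝔸) ∈ H := ⟨1, map_one ρ⟩
  have hmul : ∀ a ∈ H, ∀ b ∈ H, a * b ∈ H := by
    rintro _ ⟨a, rfl⟩ _ ⟨b, rfl⟩; exact ⟨a * b, map_mul ρ a b⟩
  have hinv : ∀ a ∈ H, ∃ b ∈ H, b * a = 1 := by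
    rintro _ ⟨a, rfl⟩; exact ⟨ρ a⁻¹, ⟨a⁻¹, rfl⟩, by rw [← map_mul, inv_mul_cancel, map_one]⟩
  obtain ⟨𝔥, h𝔥⟩ := exists_lieSubmodule_range ρ hH
  obtain ⟨𝔨, hc⟩ := Submodule.exists_isCompl 𝔥
  obtain ⟨r, hr, -, q, a, hTopen, hqa, hrep, hequiv, hqan, haan⟩ :=
    exists_tubularMaps hH h1 hmul hinv 𝔥 𝔨 h𝔥 hc
  set T : Set 𝔸 := {M : 𝔸 | ∃ h ∈ H, ∃ A ∈ 𝔨, ‖A‖ < r ∧ M = h * (1 + A)} with hTdef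
  -- Euclidean coordinates of `𝔸` and the cut-off radius `ρ₀`
  set e : 𝔸 ≃L[ℝ] EuclideanSpace ℝ (Fin (Module.finrank ℝ 𝔸)) := toEuclidean with he
  set Ce : ℝ := ‖(e.symm : EuclideanSpace ℝ (Fin (Module.finrank ℝ 𝔸)) →L[ℝ] 𝔸)‖ with hCe
  have hCe0 : 0 ≤ Ce := norm_nonneg _
  set ρ₀ : ℝ := r / (2 * (Ce + 1)) with hρ₀
  have hρ₀pos : 0 < ρ₀ := by positivity
  have hCeρ₀ : Ce * ρ₀ < r := by
    rw [hρ₀, mul_div_assoc', div_lt_iff₀ (by positivity)]; nlinarith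
  have hnormA : ∀ A : 𝔸, ‖A‖ ≤ Ce * ‖e A‖ := fun A => by
    calc ‖A‖ = ‖(e.symm : _ →L[ℝ] 𝔸) (e A)‖ := by simp
      _ ≤ Ce * ‖e A‖ := ContinuousLinearMap.le_opNorm _ _
  have hsq : ∀ A : 𝔸, ‖e A‖ ^ 2 = ∑ i, (e A i) ^ 2 := fun A => by
    rw [EuclideanSpace.norm_eq, Real.sq_sqrt (Finset.sum_nonneg fun i _ => by positivity)]
    exact Finset.sum_congr rfl fun i _ => by rw [Real.norm_eq_abs, sq_abs]
  have hsmall : ∀ A : 𝔸, ∑ i, (e A i) ^ 2 ≤ ρ₀ ^ 2 → ‖A‖ < r := fun A hA => by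
    rw [← hsq] at hA
    have h1' : ‖e A‖ ≤ ρ₀ := (pow_le_pow_iff_left₀ (norm_nonneg _) hρ₀pos.le two_ne_zero).1 hA
    calc ‖A‖ ≤ Ce * ‖e A‖ := hnormA A
      _ ≤ Ce * ρ₀ := mul_le_mul_of_nonneg_left h1' hCe0
      _ < r := hCeρ₀
  -- the cut-off function, the compact tube `Ω`, and the lift `qK`
  let g : 𝔸 → ℝ := fun M => ρ₀ ^ 2 - ∑ i, (e (a M) i) ^ 2
  set Ω : Set 𝔸 := {M ∈ T | 0 ≤ g M} with hΩdef
  haveI : Nonempty K := ⟨1⟩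
  let qK : 𝔸 → K := fun M => invFun ρ (q M)
  -- `1 ∈ T`, `q 1 = 1`, `a 1 = 0`
  have h0r : ‖(0 : 𝔸)‖ < r := by simpa using hr
  have h1T : (1 : 𝔸) ∈ T := ⟨1, h1, 0, 𝔨.zero_mem, h0r, by simp⟩
  have hq1 : q 1 = 1 ∧ a 1 = 0 := by
    have := hqa 1 h1 0 𝔨.zero_mem h0r
    simpa using this
  -- membership in `Ω`
  have hΩmem : ∀ M : 𝔸, M ∈ Ω ↔ ∃ k : K, ∃ A ∈ 𝔨, ∑ i, (e A i) ^ 2 ≤ ρ₀ ^ 2 ∧ M = ρ k * (1 + A) := by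
    intro M
    constructor
    · rintro ⟨hMT, hgM⟩
      obtain ⟨hqH, haK, -, hMeq⟩ := hrep M hMT
      obtain ⟨k, hk⟩ := hqH
      refine ⟨k, a M, haK, ?_, by rw [hk]; exact hMeq⟩
      have : 0 ≤ ρ₀ ^ 2 - ∑ i, (e (a M) i) ^ 2 := hgM
      linarith
    · rintro ⟨k, A, hA, hAρ, rfl⟩
      have hAr : ‖A‖ < r := hsmall A hAρ
      have hMT : ρ k * (1 + A) ∈ T := ⟨ρ k, ⟨k, rfl⟩, A, hA, hAr, rfl⟩
      refine ⟨hMT, ?_⟩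
      show 0 ≤ ρ₀ ^ 2 - ∑ i, (e (a (ρ k * (1 + A))) i) ^ 2
      rw [(hqa (ρ k) ⟨k, rfl⟩ A hA hAr).2]
      linarith
  have hΩT : Ω ⊆ T := fun M hM => hM.1
  -- compactness of `Ω`
  have hKA : IsCompact {A : 𝔸 | A ∈ 𝔨 ∧ ∑ i, (e A i) ^ 2 ≤ ρ₀ ^ 2} := by
    refine Metric.isCompact_of_isClosed_isBounded ?_ ?_
    · refine (𝔨.closed_of_finiteDimensional).inter ?_
      have hcont : Continuous fun A : 𝔸 => ∑ i, (e A i) ^ 2 :=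
        continuous_finsetSum _ fun i _ =>
          (((EuclideanSpace.proj (𝕜 := ℝ) (ι := Fin (Module.finrank ℝ 𝔸)) i).continuous).comp
            e.continuous).pow 2
      exact isClosed_le hcont continuous_const
    · refine (Metric.isBounded_closedBall (x := (0 : 𝔸)) (r := r)).subset ?_
      rintro A ⟨-, hA⟩
      rw [mem_closedBall_zero_iff]
      exact (hsmall A hA).le
  have hΩeq : Ω = (fun p : K × 𝔸 => ρ p.1 * (1 + p.2)) '' (univ ×ˢ {A : 𝔸 | A ∈ 𝔨 ∧ ∑ i, (e A i) ^ 2 ≤ ρ₀ ^ 2}) := by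
    ext M
    rw [hΩmem]
    simp only [mem_image, mem_prod, mem_univ, true_and, mem_setOf_eq, Prod.exists]
    constructor
    · rintro ⟨k, A, hA, hAρ, rfl⟩; exact ⟨k, A, ⟨hA, hAρ⟩, rfl⟩
    · rintro ⟨k, A, ⟨hA, hAρ⟩, rfl⟩; exact ⟨k, A, hA, hAρ, rfl⟩
  have hΩcpt : IsCompact Ω := by
    rw [hΩeq]
    exact (isCompact_univ.prod hKA).image (by fun_prop)
  -- analyticity of `g` on `T`
  have hgan : AnalyticOnNhd ℝ g T := by
    have hcoord : ∀ i, AnalyticOnNhd ℝ (fun M => e (a M) i) T := fun i => by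
      have hL : AnalyticOnNhd ℝ (fun x : 𝔸 => e x i) univ := fun x _ =>
        ((EuclideanSpace.proj (𝕜 := ℝ) i).analyticAt _).comp (f := fun y : 𝔸 => e y)
          ((e : 𝔸 →L[ℝ] EuclideanSpace ℝ (Fin (Module.finrank ℝ 𝔸))).analyticAt x)
      exact hL.comp haan (mapsTo_univ _ _)
    show AnalyticOnNhd ℝ (fun M => ρ₀ ^ 2 - ∑ i, (e (a M) i) ^ 2) T
    refine analyticOnNhd_const.sub ?_
    exact Finset.analyticOnNhd_fun_sum _ fun i _ => (hcoord i).pow 2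
  -- `1 ∈ interior Ω`
  have hg1 : g 1 = ρ₀ ^ 2 := by
    show ρ₀ ^ 2 - ∑ i, (e (a 1) i) ^ 2 = ρ₀ ^ 2
    rw [hq1.2, map_zero]; simp
  have h1int : (1 : 𝔸) ∈ interior Ω := by
    rw [mem_interior_iff_mem_nhds]
    have hT1 : T ∈ 𝓝 (1 : 𝔸) := hTopen.mem_nhds h1T
    have hgc : ContinuousAt g 1 := (hgan 1 h1T).continuousAt
    have hpos : ∀ᶠ M in 𝓝 (1 : 𝔸), 0 < g M :=
      hgc.eventually (lt_mem_nhds (by rw [hg1]; positivity))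
    filter_upwards [hT1, hpos] with M hMT hgM
    exact ⟨hMT, hgM.le⟩
  -- the lift `qK`
  have hqK : ∀ M ∈ T, ρ (qK M) = q M := fun M hM => invFun_eq (hrep M hM).1
  have hqKcont : ContinuousOn qK T :=
    (continuousOn_invFun_range hρc hρi).comp hqan.continuousOn fun M hM => (hrep M hM).1
  -- invariance
  have hTinv : ∀ k : K, ∀ M ∈ T, ρ k * M ∈ T ∧ qK (ρ k * M) = k * qK M := by
    intro k M hM
    obtain ⟨hkM, hqkM, -⟩ := hequiv (ρ k) ⟨k, rfl⟩ M hM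
    refine ⟨hkM, hρi ?_⟩
    rw [hqK _ hkM, hqkM, map_mul, hqK _ hM]
  have hΩinv : ∀ k : K, (fun M => ρ k * M) ⁻¹' Ω = Ω := by
    intro k
    have key : ∀ (k : K) (M : 𝔸), M ∈ Ω → ρ k * M ∈ Ω := by
      rintro k M ⟨hMT, hgM⟩
      obtain ⟨hkM, -, hakM⟩ := hequiv (ρ k) ⟨k, rfl⟩ M hMT
      refine ⟨hkM, ?_⟩
      show 0 ≤ ρ₀ ^ 2 - ∑ i, (e (a (ρ k * M)) i) ^ 2
      rw [hakM]; exact hgM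
    ext M
    simp only [mem_preimage]
    refine ⟨fun hM => ?_, key k M⟩
    have := key k⁻¹ _ hM
    rwa [← mul_assoc, ← map_mul, inv_mul_cancel, map_one, one_mul] at this

  exact ⟨𝔨, r, ρ₀, T, Ω, q, a, g, qK, hr, hρ₀pos, rfl, rfl, rfl, hTopen, hΩT, hΩcpt, h1int,
    hqa, hrep, hequiv, hqan, haan, hsmall, hqKcont, hq1.1, hqK, hTinv, hΩinv⟩

end Tube

end Literature.MeasureTheory.Group

end
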